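import Mathlib
import Summits.KontsevichZagierPeriods.Zeta5Search.ResidueLaw
import Summits.KontsevichZagierPeriods.Zeta5Search.PolynomialResidues
import Summits.KontsevichZagierPeriods.Zeta5Search.ResidueIdentityProof
import HarnessLib

/-!
# ζ(5) search — THEOREM R∞: the residue identity WITH the term at infinity (no degree condition)

HONEST FRAMING: systematic search; no irrationality claim unless certified.

Cell `pub-zeta5`, prover seat p3 (gen 2); statement asked for by gen-2 g12 (REPORT-gen2-g12 §1, "THEOREM R∞", proved there on
paper and exact-checked; "Lean-friendly form = coeff (natDegree Den − 1) ((h·N) %ₘ Den)").  `residueIdentity_infty`: for a prime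
`p ≥ 3`, `M ≥ 2`, `E : ℕ → ℤ` with `E_y ≥ −M` (`y < p`) and ANY `h ∈ F_p[t]`,
`Σ_{E_x=−M} (h'(−x)ḡ_x + h(−x)ḡ_xφ̄_x) + Σ_{E_x=−M+1} h(−x)ḡ_x = (−1)^M · coeff_{n−1}((h·N) mod D)`,
where `N = ∏_{y<p, e_y ≥ 0} (X + y)^{e_y}`, `D = ∏_{x<p, e_x<0} (X + x)^{−e_x}`, `e = E + M − 2`, `n = deg D = Σ_{e_x<0} (−e_x)`
(so `h·N/D = h·∏_y (X+y)^{E_y}·(X^p − X)^{M−2}` and the right-hand side is `(−1)^M` times minus its residue at infinity;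
under gen-2 g11's degree condition DEG it vanishes and the statement is `residueIdentity_holds`).
Proof = the proof of `residueIdentity_holds` with `PolynomialResidues.sum_res_eq_coeff_modByMonic` (Σ residues = top coefficient
of `A mod B`, no degree hypothesis) in place of `sum_res_eq_zero`.  Nothing here bears on irrationality.
-/

open Finset Polynomial

namespace Summit.KontsevichZagierPeriods.Zeta5Search.ResidueLaw

open Summit.KontsevichZagierPeriods.Zeta5Search.PolynomialResidues

/-- **THEOREM R∞ (REPORT-gen2-g12 §1).**  The residue identity without degree condition: the finite residue sum equals
`(−1)^M` times the coefficient of `X^{deg D − 1}` in `(h·N) mod D` (notation in the module docstring). -/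
theorem residueIdentity_infty (p M : ℕ) (E : ℕ → ℤ) (h : Polynomial (ZMod p)) (hp : p.Prime) (hp3 : 3 ≤ p) (hM : 2 ≤ M)
    (hE : ∀ x, x < p → -(M : ℤ) ≤ E x) :
    (∑ x ∈ (range p).filter (fun x => E x = -(M : ℤ)),
        ((derivative h).eval (-(x : ZMod p)) * gBarE p E x + h.eval (-(x : ZMod p)) * gBarE p E x * phiBarE p E x))
      + (∑ x ∈ (range p).filter (fun x => E x = -(M : ℤ) + 1), h.eval (-(x : ZMod p)) * gBarE p E x)
    = (-1 : ZMod p) ^ M *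
      ((h * ∏ y ∈ (range p).filter (fun y => 0 ≤ E y + (M : ℤ) - 2), (X + C ((y : ℕ) : ZMod p)) ^ (E y + (M : ℤ) - 2).toNat)
        %ₘ ∏ x ∈ (range p).filter (fun x => E x + (M : ℤ) - 2 < 0), (X + C ((x : ℕ) : ZMod p)) ^ (-(E x + (M : ℤ) - 2)).toNat).coeff
        ((∑ x ∈ (range p).filter (fun x => E x + (M : ℤ) - 2 < 0), (-(E x + (M : ℤ) - 2)).toNat) - 1) := by
  haveI : Fact p.Prime := ⟨hp⟩
  have hXC : ∀ y : ℕ, (X + C ((y : ℕ) : ZMod p) : (ZMod p)[X]) = X - C (-((y : ℕ) : ZMod p)) := fun y => by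
    rw [C_neg, sub_neg_eq_add]
  simp_rw [hXC]
  -- the pole set `S = {e < 0}`, the regular set `T = {e ≥ 0}`, `e_y = E_y + M − 2`
  set S : Finset ℕ := (range p).filter (fun x => E x + (M : ℤ) - 2 < 0) with hS
  set T : Finset ℕ := (range p).filter (fun x => 0 ≤ E x + (M : ℤ) - 2) with hT
  set P : (ZMod p)[X] := ∏ y ∈ T, (X - C (-((y : ℕ) : ZMod p))) ^ (E y + (M : ℤ) - 2).toNat with hP
  have hmemS : ∀ {x}, x ∈ S ↔ x < p ∧ E x + (M : ℤ) - 2 < 0 := by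
    intro x; simp only [hS, Finset.mem_filter, Finset.mem_range]
  have hmemT : ∀ {x}, x ∈ T ↔ x < p ∧ 0 ≤ E x + (M : ℤ) - 2 := by
    intro x; simp only [hT, Finset.mem_filter, Finset.mem_range]
  have hcast : ∀ {x y : ℕ}, x < p → y < p → (x : ZMod p) = (y : ZMod p) → x = y := by
    intro x y hx hy hxy
    have h' := congrArg ZMod.val hxy
    rwa [ZMod.val_cast_of_lt hx, ZMod.val_cast_of_lt hy] at h'
  have hsub : ∀ x y : ℕ, -((x : ℕ) : ZMod p) - -((y : ℕ) : ZMod p) = (y : ZMod p) - (x : ZMod p) :=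
    fun x y => neg_sub_neg _ _
  -- hypotheses of the algebraic residue theorem
  have hinj : Set.InjOn (fun x : ℕ => -((x : ℕ) : ZMod p)) (S : Set ℕ) := by
    intro x hx y hy hxy
    exact hcast (hmemS.1 (Finset.mem_coe.1 hx)).1 (hmemS.1 (Finset.mem_coe.1 hy)).1 (neg_inj.1 hxy)
  have hm12 : ∀ x ∈ S, (fun x : ℕ => (-(E x + (M : ℤ) - 2)).toNat) x = 1
      ∨ (fun x : ℕ => (-(E x + (M : ℤ) - 2)).toNat) x = 2 := by
    intro x hx
    obtain ⟨hxp, hex⟩ := hmemS.1 hx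
    have h1 := hE x hxp
    rcases (show -(E x + (M : ℤ) - 2) = 1 ∨ -(E x + (M : ℤ) - 2) = 2 by omega) with h2 | h2
    · left; simp only [h2]; rfl
    · right; simp only [h2]; rfl
  have hres := sum_res_eq_coeff_modByMonic S (fun x : ℕ => -((x : ℕ) : ZMod p))
    (fun x : ℕ => (-(E x + (M : ℤ) - 2)).toNat) hinj hm12 (h * P)
  -- the residue at each pole, in closed form
  have hterm : ∀ x ∈ S, res S (fun x : ℕ => -((x : ℕ) : ZMod p)) (fun x : ℕ => (-(E x + (M : ℤ) - 2)).toNat)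
      (h * P) x = (-1 : ZMod p) ^ (M - 2) * (if E x = -(M : ℤ) then
        ((derivative h).eval (-(x : ZMod p)) * gBarE p E x + h.eval (-(x : ZMod p)) * gBarE p E x * phiBarE p E x)
        else h.eval (-(x : ZMod p)) * gBarE p E x) := by
    intro x hx
    obtain ⟨hxp, hex⟩ := hmemS.1 hx
    have hEx := hE x hxp
    -- the relevant points are distinct from `x`
    have hzT : ∀ y ∈ T, -((x : ℕ) : ZMod p) - -((y : ℕ) : ZMod p) ≠ 0 := by
      intro y hy
      obtain ⟨hyp, hey⟩ := hmemT.1 hy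
      rw [hsub]
      exact sub_ne_zero.2 fun h' => by have := hcast hyp hxp h'; subst this; omega
    have hzS : ∀ y ∈ S.erase x, -((x : ℕ) : ZMod p) - -((y : ℕ) : ZMod p) ≠ 0 := by
      intro y hy
      obtain ⟨hyx, hyS⟩ := Finset.mem_erase.1 hy
      rw [hsub]
      exact sub_ne_zero.2 fun h' => hyx (hcast (hmemS.1 hyS).1 hxp h')
    -- values of `P`, `P'`, `C`, `C'` at `−x`
    have hPz : P.eval (-((x : ℕ) : ZMod p))
        = ∏ y ∈ T, (-((x : ℕ) : ZMod p) - -((y : ℕ) : ZMod p)) ^ (E y + (M : ℤ) - 2).toNat :=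
      eval_prod_pow_X_sub_C _ _ _ _
    have hP'z : (derivative P).eval (-((x : ℕ) : ZMod p)) = P.eval (-((x : ℕ) : ZMod p))
        * ∑ y ∈ T, (((E y + (M : ℤ) - 2).toNat : ℕ) : ZMod p) / (-((x : ℕ) : ZMod p) - -((y : ℕ) : ZMod p)) := by
      rw [hPz]
      exact eval_derivative_prod_pow_X_sub_C T _ _ _ hzT
    set Cf := cofactor S (fun x : ℕ => -((x : ℕ) : ZMod p)) (fun x : ℕ => (-(E x + (M : ℤ) - 2)).toNat) x
      with hCf
    have hCz : Cf.eval (-((x : ℕ) : ZMod p))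
        = ∏ y ∈ S.erase x, (-((x : ℕ) : ZMod p) - -((y : ℕ) : ZMod p)) ^ (-(E y + (M : ℤ) - 2)).toNat :=
      eval_cofactor _ _ _ _ _
    have hC'z : (derivative Cf).eval (-((x : ℕ) : ZMod p)) = Cf.eval (-((x : ℕ) : ZMod p))
        * ∑ y ∈ S.erase x, (((-(E y + (M : ℤ) - 2)).toNat : ℕ) : ZMod p)
            / (-((x : ℕ) : ZMod p) - -((y : ℕ) : ZMod p)) := by
      rw [hCz]
      exact eval_derivative_prod_pow_X_sub_C (S.erase x) _ _ _ hzS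
    have hC0 : Cf.eval (-((x : ℕ) : ZMod p)) ≠ 0 := eval_cofactor_self_ne_zero S _ _ hinj hx
    -- `(range p) ∖ {x}` splits into `T` and `S ∖ {x}`
    have hUT : ((range p).erase x).filter (fun y => 0 ≤ E y + (M : ℤ) - 2) = T := by
      ext y
      simp only [Finset.mem_filter, Finset.mem_erase, Finset.mem_range, hT]
      constructor
      · rintro ⟨⟨-, hyp⟩, hy⟩; exact ⟨hyp, hy⟩
      · rintro ⟨hyp, hy⟩; exact ⟨⟨by rintro rfl; omega, hyp⟩, hy⟩
    have hUS : ((range p).erase x).filter (fun y => E y + (M : ℤ) - 2 < 0) = S.erase x := by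
      ext y
      simp only [Finset.mem_filter, Finset.mem_erase, Finset.mem_range, hS]
      constructor
      · rintro ⟨⟨hyx, hyp⟩, hy⟩; exact ⟨hyx, hyp, hy⟩
      · rintro ⟨hyx, hyp, hy⟩; exact ⟨⟨hyx, hyp⟩, hy⟩
    -- the quotient `P(−x)/C(−x) = (−1)^{M−2} ḡ_x`
    have hG : P.eval (-((x : ℕ) : ZMod p)) / Cf.eval (-((x : ℕ) : ZMod p)) = (-1 : ZMod p) ^ (M - 2) * gBarE p E x := by
      rw [hPz, hCz, ← hUT, ← hUS, ← prod_zpow_eq_div ((range p).erase x) (fun y => E y + (M : ℤ) - 2)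
        (fun y => (E y + (M : ℤ) - 2).toNat) (fun y => (-(E y + (M : ℤ) - 2)).toNat)
        (fun y => -((x : ℕ) : ZMod p) - -((y : ℕ) : ZMod p))
        (fun y _ hy => Int.toNat_of_nonneg hy) (fun y _ hy => Int.toNat_of_nonneg (by omega))]
      simp only [hsub]
      exact prod_zpow_shift_eq E M hM hxp
    -- the logarithmic-derivative difference `Σ_T − Σ_{S∖x} = φ̄_x`
    have hPsi : (∑ y ∈ T, (((E y + (M : ℤ) - 2).toNat : ℕ) : ZMod p) / (-((x : ℕ) : ZMod p) - -((y : ℕ) : ZMod p)))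
        - ∑ y ∈ S.erase x, (((-(E y + (M : ℤ) - 2)).toNat : ℕ) : ZMod p)
            / (-((x : ℕ) : ZMod p) - -((y : ℕ) : ZMod p)) = phiBarE p E x := by
      rw [← hUT, ← hUS, ← sum_intCast_div_eq_sub ((range p).erase x) (fun y => E y + (M : ℤ) - 2)
        (fun y => (E y + (M : ℤ) - 2).toNat) (fun y => (-(E y + (M : ℤ) - 2)).toNat)
        (fun y => -((x : ℕ) : ZMod p) - -((y : ℕ) : ZMod p))
        (fun y _ hy => Int.toNat_of_nonneg hy) (fun y _ hy => Int.toNat_of_nonneg (by omega))]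
      simp only [hsub]
      exact sum_shift_div_eq E M hp3 hxp
    -- simple or double pole
    rcases (show E x = -(M : ℤ) ∨ E x = -(M : ℤ) + 1 by omega) with hEq | hEq
    · have hmx : (fun x : ℕ => (-(E x + (M : ℤ) - 2)).toNat) x ≠ 1 := by
        show (-(E x + (M : ℤ) - 2)).toNat ≠ 1
        rw [hEq, show -(-(M : ℤ) + (M : ℤ) - 2) = 2 by ring]
        decide
      rw [if_pos hEq, res, if_neg hmx]
      change ((derivative (h * P)).eval (-((x : ℕ) : ZMod p)) * Cf.eval (-((x : ℕ) : ZMod p))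
          - (h * P).eval (-((x : ℕ) : ZMod p)) * (derivative Cf).eval (-((x : ℕ) : ZMod p)))
          / Cf.eval (-((x : ℕ) : ZMod p)) ^ 2 = _
      rw [derivative_mul, eval_add, eval_mul, eval_mul, eval_mul, hP'z, hC'z, (div_eq_iff hC0).1 hG,
        eq_add_of_sub_eq hPsi]
      field_simp
      ring
    · have hmx : (fun x : ℕ => (-(E x + (M : ℤ) - 2)).toNat) x = 1 := by
        show (-(E x + (M : ℤ) - 2)).toNat = 1
        rw [hEq, show -(-(M : ℤ) + 1 + (M : ℤ) - 2) = 1 by ring]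
        decide
      have hne : ¬ E x = -(M : ℤ) := by omega
      rw [if_neg hne, res, if_pos hmx]
      change (h * P).eval (-((x : ℕ) : ZMod p)) / Cf.eval (-((x : ℕ) : ZMod p)) = _
      rw [eval_mul, mul_div_assoc, hG]
      ring
  -- sum up: `Σ_S res = (−1)^{M−2} · (the two sums)` and `Σ_S res = coeff_{n−1}((hP) mod D)`
  rw [Finset.sum_congr rfl hterm, ← Finset.mul_sum, Finset.sum_ite] at hres
  have hS1 : S.filter (fun x => E x = -(M : ℤ)) = (range p).filter (fun x => E x = -(M : ℤ)) := by
    ext x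
    simp only [Finset.mem_filter, Finset.mem_range, hS]
    constructor
    · rintro ⟨⟨hxp, -⟩, hx⟩; exact ⟨hxp, hx⟩
    · rintro ⟨hxp, hx⟩; exact ⟨⟨hxp, by omega⟩, hx⟩
  have hS2 : S.filter (fun x => ¬ E x = -(M : ℤ)) = (range p).filter (fun x => E x = -(M : ℤ) + 1) := by
    ext x
    simp only [Finset.mem_filter, Finset.mem_range, hS]
    constructor
    · rintro ⟨⟨hxp, hex⟩, hx⟩; have := hE x hxp; exact ⟨hxp, by omega⟩
    · rintro ⟨hxp, hx⟩; exact ⟨⟨hxp, by omega⟩, by omega⟩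
  rw [hS1, hS2] at hres
  have hu2 : ((-1 : ZMod p) ^ (M - 2)) * ((-1 : ZMod p) ^ (M - 2)) = 1 := by
    rw [← pow_add, ← two_mul, pow_mul]
    norm_num
  have hM2 : (-1 : ZMod p) ^ M = (-1 : ZMod p) ^ (M - 2) := by
    rw [show M = (M - 2) + 2 by omega, pow_add, Nat.add_sub_cancel]
    norm_num
  rw [hM2, ← hres, ← mul_assoc, hu2, one_mul]

end Summit.KontsevichZagierPeriods.Zeta5Search.ResidueLaw
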